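import Summits.RiemannHypothesis.RiemannHypothesis.Theorems.WeilArchPanelsP72EE72v1D
import Summits.RiemannHypothesis.RiemannHypothesis.Theorems.WeilArchPanelsM77YW77v1D
import Summits.RiemannHypothesis.RiemannHypothesis.Theorems.WeilArchPanelsM78YW78v1D
import Summits.RiemannHypothesis.RiemannHypothesis.Theorems.WeilArchPanelsM78FF78v1D
import Summits.RiemannHypothesis.RiemannHypothesis.Theorems.WeilArchPanelsM80PP80v1D
import Summits.RiemannHypothesis.RiemannHypothesis.Theorems.WeilArchPanelsM80FF80v1D
import Summits.RiemannHypothesis.RiemannHypothesis.Theorems.WeilArchPanelsN25ENe25v1D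
import Summits.RiemannHypothesis.RiemannHypothesis.Theorems.WeilArchPanelsN25ONo25v1D
import Summits.RiemannHypothesis.RiemannHypothesis.Theorems.WeilArchPanelsN83ENe83v1D
import Summits.RiemannHypothesis.RiemannHypothesis.Theorems.WeilArchPanelsN83ONo83v1D
import Literature.Analysis.ValidatedNumerics.ExpPoly.Poly
import HarnessLib

/-!
# Sign certificates for Ritz polynomials: a kernel checker for `P > 0` on an interval (one-sided Taylor panels)

Support file for crux `PolarPerronFrobenius` (item stmt-RiemannHypothesis-18390 of route GroundBarta; prover B g16),
RH-free and purely about exact rational polynomials (`Poly = List ℚ` of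
`Literature/Analysis/ValidatedNumerics/ExpPoly/Poly.lean`, Horner evaluation `Poly.eval`).

The crux asks for a ONE-SIGNED ground state of the full windowed Weil form at even-winning windows beyond every height.
The certified cells of the parity ladder (`18/25`, `77/100`, `39/50`, `4023/5000`, `(log 5)/2`, `83/100`) each carry an
explicit Rayleigh–Ritz trial polynomial `P` (`v(x) = P(x/b)` on `[-b, b]`, data modules `WeilArchPanels<CELL>v1D`), whose
Rayleigh quotient realises the landed U-sides (`trialUpper80sharp`, `trialUpper83sharp`, …).  This file provides the
checker that turns "the Ritz ground vector is one-signed" into a `decide`: for a panel `[e - r, e]` re-expand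
`P(e - s) = Σ_k q_k s^k` exactly (`Poly.shift`) and use the ONE-SIDED bound, valid for `0 ≤ s ≤ r`,
`P(e - s) ≥ q₀ + Σ_{k ≥ 1} min(0, q_k) r^k` (`rs_panel_pos`); a chain of such panels from the right end `e₀` down past `u`
proves `0 < P` on `[u, e₀]` (`rs_chain_pos`).  Anchoring at the RIGHT end is what makes the certificate cheap for a
vector that decays towards the window edge: there `q₁ = -P'(e) ≥ 0`, so the dominant first-order term costs nothing
(9–12 panels per vector instead of hundreds for the symmetric bound).  Parity transport: `rs_parity_eval_neg`
(vanishing odd / even coefficients, a decidable fold) with `eval P (-y) = ± eval P y`, and the packaged statements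
`rs_pos_Icc_of_even` (`P > 0` on `[-1, 1]`) and `rs_sign_of_odd` (`P > 0` on `(0, 1]`, `P < 0` on `[-1, 0)`: exactly one node).
The last section applies it to the ten certified Ritz ground vectors of the tree (data modules `WeilArchPanels<CELL>v1D`, provers A/B of
the GroundBarta cells): the four EVEN vectors (`18/25`, `4023/5000`, `(log 5)/2`, `83/100`) are strictly positive on the closed window,
the six ODD ones (`77/100`, `39/50` plain and deflated, `4023/5000` deflated, `(log 5)/2`, `83/100`) have exactly one node, at the
centre — the Sturm ground-state pattern of each parity sector, now a kernel fact (`decide`, 9–12 panels per vector).  With the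
certified parity order `ε_ev < ε_od` on these windows (parity ladder) this is the data-level form of GSP / Perron–Frobenius at
`a ∈ {0.72, 0.8046, 0.8047, 0.83}`, far beyond the analytic sign-improving threshold `11/40` of `…EvenThreshold`.

NOT here: any statement about the true ground state `u` of the windowed form (that needs a certified spectral gap and an
edge-layer argument — see the crux's evidence note GSP-EVIDENCE-B-g15); root isolation / Sturm sequences (not needed).
Design: the checkers are CLOSED TERMS built from `List.foldr`, `Poly.shift`, `min` and `decide` (no new definitions), written out in
the hypotheses of the soundness theorems; use sites never spell them (`by decide +kernel` against the inferred statement).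
References: Horner's rule; Taylor re-expansion of a polynomial [folklore].
-/

set_option linter.dupNamespace false

namespace Summit.RiemannHypothesis.RiemannHypothesis.Theorems.PolarPerronFrobenius

open Literature.Analysis.ValidatedNumerics.ExpPoly Set

/-! ## Re-expansion at a right anchor -/

/-- `Poly.shift` is the re-expansion in `s = e - y`: `eval (shift P e) s = eval P (e - s)`. [folklore] -/
theorem eval_shift_eq (e : ℚ) (s : ℝ) : ∀ P : Poly, Poly.eval (Poly.shift P e) s = Poly.eval P ((e : ℝ) - s)
  | [] => by simp [Poly.eval_shift_nil]
  | c :: P => by rw [Poly.eval_shift_cons, Poly.eval_cons, eval_shift_eq e s P]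

/-! ## The one-sided panel bound

The checker terms (all closed, kernel-evaluable):
* negative tail `NT(q, r) := q.foldr (fun c t => min 0 c + r * t) 0 = Σ_k min(0, q_k) r^k`;
* panel bound `LB(q, r) := q.headD 0 + r * NT(q.tail, r)`, a lower bound of `eval q` on `[0, r]`;
* chain `CH(P, e, rs, u) := rs.foldr (fun r k e => 0 < r ∧ 0 < LB(shift P e, r) ∧ k (e - r)) (fun e => e < u) e` (as `Bool`). -/

/-- The negative tail is `≤ 0` (`r ≥ 0`). [folklore] -/
theorem rs_negTail_nonpos : ∀ (q : Poly) (r : ℚ), 0 ≤ r → q.foldr (fun c t => min 0 c + r * t) 0 ≤ 0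
  | [], _, _ => le_rfl
  | c :: q, r, hr => by
      have ih := rs_negTail_nonpos q r hr
      have hmin : min 0 c ≤ 0 := min_le_left 0 c
      simp only [List.foldr_cons]
      nlinarith

/-- Soundness of the negative tail: for `0 ≤ s ≤ r`, `NT(q, r) ≤ eval q s` (termwise `q_k s^k ≥ min(0, q_k) r^k`). [folklore] -/
theorem rs_negTail_le_eval : ∀ (q : Poly) (r : ℚ), 0 ≤ r → ∀ s : ℝ, 0 ≤ s → s ≤ r →
    ((q.foldr (fun c t => min 0 c + r * t) 0 : ℚ) : ℝ) ≤ Poly.eval q s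
  | [], r, _, s, _, _ => by simp
  | c :: q, r, hr, s, hs, hsr => by
      have ih := rs_negTail_le_eval q r hr s hs hsr
      have hN : ((q.foldr (fun c t => min 0 c + r * t) 0 : ℚ) : ℝ) ≤ 0 := by
        exact_mod_cast rs_negTail_nonpos q r hr
      have hmin : ((min 0 c : ℚ) : ℝ) ≤ (c : ℝ) := by exact_mod_cast min_le_right 0 c
      have h1 : s * ((q.foldr (fun c t => min 0 c + r * t) 0 : ℚ) : ℝ) ≤ s * Poly.eval q s :=
        mul_le_mul_of_nonneg_left ih hs
      have h2 : (r : ℝ) * ((q.foldr (fun c t => min 0 c + r * t) 0 : ℚ) : ℝ) ≤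
          s * ((q.foldr (fun c t => min 0 c + r * t) 0 : ℚ) : ℝ) := by nlinarith
      simp only [List.foldr_cons, Poly.eval_cons, Rat.cast_add, Rat.cast_mul]
      linarith

/-- Soundness of the panel bound: for `0 ≤ s ≤ r`, `LB(q, r) ≤ eval q s`. [folklore] -/
theorem rs_lowBound_le_eval : ∀ (q : Poly) (r : ℚ), 0 ≤ r → ∀ s : ℝ, 0 ≤ s → s ≤ r →
    ((q.headD 0 + r * q.tail.foldr (fun c t => min 0 c + r * t) 0 : ℚ) : ℝ) ≤ Poly.eval q s
  | [], r, _, s, _, _ => by simp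
  | c :: q, r, hr, s, hs, hsr => by
      have ih := rs_negTail_le_eval q r hr s hs hsr
      have hN : ((q.foldr (fun c t => min 0 c + r * t) 0 : ℚ) : ℝ) ≤ 0 := by
        exact_mod_cast rs_negTail_nonpos q r hr
      have h1 : s * ((q.foldr (fun c t => min 0 c + r * t) 0 : ℚ) : ℝ) ≤ s * Poly.eval q s :=
        mul_le_mul_of_nonneg_left ih hs
      have h2 : (r : ℝ) * ((q.foldr (fun c t => min 0 c + r * t) 0 : ℚ) : ℝ) ≤
          s * ((q.foldr (fun c t => min 0 c + r * t) 0 : ℚ) : ℝ) := by nlinarith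
      simp only [List.headD_cons, List.tail_cons, Poly.eval_cons, Rat.cast_add, Rat.cast_mul]
      linarith

/-- One right-anchored panel: if `0 < LB(shift P e, r)` then `0 < P` on `[e - r, e]`. [folklore] -/
theorem rs_panel_pos (P : Poly) (e r : ℚ) (hr : 0 ≤ r)
    (h : 0 < (Poly.shift P e).headD 0 + r * (Poly.shift P e).tail.foldr (fun c t => min 0 c + r * t) 0)
    (y : ℝ) (hlo : (e : ℝ) - r ≤ y) (hhi : y ≤ e) : 0 < Poly.eval P y := by
  have hb := rs_lowBound_le_eval (Poly.shift P e) r hr ((e : ℝ) - y) (by linarith) (by linarith)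
  rw [eval_shift_eq] at hb
  have hpos : (0 : ℝ) < ((((Poly.shift P e).headD 0 +
      r * (Poly.shift P e).tail.foldr (fun c t => min 0 c + r * t) 0 : ℚ)) : ℝ) := by exact_mod_cast h
  have : ((e : ℝ) - ((e : ℝ) - y)) = y := by ring
  rw [this] at hb
  linarith

/-! ## Chains of panels -/

/-- Soundness of the chain: `CH(P, e, rs, u) = true → 0 < P` on `[u, e]` (the panels of radii `rs`, each positive and each
passing the one-sided bound, walk from the right anchor `e` strictly past `u`). [folklore] -/
theorem rs_chain_pos (P : Poly) (u : ℚ) : ∀ (rs : List ℚ) (e : ℚ),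
    rs.foldr (fun (r : ℚ) (k : ℚ → Bool) (e : ℚ) => decide (0 < r) &&
        decide (0 < (Poly.shift P e).headD 0 + r * (Poly.shift P e).tail.foldr (fun c t => min 0 c + r * t) 0) &&
        k (e - r)) (fun e => decide (e < u)) e = true →
    ∀ y : ℝ, (u : ℝ) ≤ y → y ≤ e → 0 < Poly.eval P y
  | [], e, h, y, hu, he => by
      have hlt : e < u := by simpa using h
      have : (e : ℝ) < u := by exact_mod_cast hlt
      linarith
  | r :: rs, e, h, y, hu, he => by
      simp only [List.foldr_cons, Bool.and_eq_true, decide_eq_true_eq] at h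
      obtain ⟨⟨hr, hlb⟩, hrest⟩ := h
      by_cases hy : (e : ℝ) - r ≤ y
      · exact rs_panel_pos P e r hr.le hlb y hy he
      · exact rs_chain_pos P u rs (e - r) hrest y hu (by push_cast; exact (not_le.mp hy).le)

/-! ## Parity transport -/

/-- The parity fold: started with flag `false` it checks that all ODD-index coefficients vanish (even list), with flag `true`
that all EVEN-index coefficients vanish (odd list); soundness: `eval P (-y) = eval P y`, resp. `= -eval P y`. [folklore] -/
theorem rs_parity_eval_neg : ∀ (P : Poly) (flag : Bool),
    P.foldr (fun (c : ℚ) (k : Bool → Bool) (odd : Bool) => (!odd || decide (c = 0)) && k (!odd)) (fun _ => true) flag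
      = true →
    ∀ y : ℝ, Poly.eval P (-y) = if flag then -Poly.eval P y else Poly.eval P y
  | [], flag, _, y => by cases flag <;> simp
  | c :: P, flag, h, y => by
      simp only [List.foldr_cons, Bool.and_eq_true] at h
      obtain ⟨hc, hrest⟩ := h
      have ih := rs_parity_eval_neg P (!flag) hrest y
      cases flag with
      | false =>
          simp only [Bool.not_false] at ih
          simp only [Poly.eval_cons, ih]
          simp only [Bool.false_eq_true, ↓reduceIte]
          ring
      | true =>
          have hc0 : c = 0 := by simpa using hc
          subst hc0
          simp only [Bool.not_true] at ih
          simp only [Poly.eval_cons, ih, Rat.cast_zero, zero_add]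
          simp only [↓reduceIte, Bool.false_eq_true]
          ring

/-! ## Packaged statements on the unit window `[-1, 1]` -/

/-- EVEN vectors: the parity fold (flag `false`) and a panel chain from `1` past `0` give `0 < P` on the whole closed window
`[-1, 1]`. [folklore] -/
theorem rs_pos_Icc_of_even (P : Poly)
    (hE : P.foldr (fun (c : ℚ) (k : Bool → Bool) (odd : Bool) => (!odd || decide (c = 0)) && k (!odd)) (fun _ => true)
      false = true)
    (rs : List ℚ)
    (h : rs.foldr (fun (r : ℚ) (k : ℚ → Bool) (e : ℚ) => decide (0 < r) &&
        decide (0 < (Poly.shift P e).headD 0 + r * (Poly.shift P e).tail.foldr (fun c t => min 0 c + r * t) 0) &&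
        k (e - r)) (fun e => decide (e < 0)) 1 = true) :
    ∀ y ∈ Icc (-1 : ℝ) 1, 0 < Poly.eval P y := by
  intro y hy
  rcases le_or_gt 0 y with h0 | h0
  · exact rs_chain_pos P 0 rs 1 h y (by simpa using h0) (by simpa using hy.2)
  · have hev := rs_parity_eval_neg P false hE y
    simp only [Bool.false_eq_true, ↓reduceIte] at hev
    rw [← hev]
    exact rs_chain_pos P 0 rs 1 h (-y) (by push_cast; linarith) (by push_cast; linarith [hy.1])

/-- ODD vectors: the parity fold (flag `true`) and a panel chain for `P.tail = P/y` from `1` past `0` give the one-node sign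
pattern `0 < P` on `(0, 1]`, `P(0) = 0`, `P < 0` on `[-1, 0)`. [folklore] -/
theorem rs_sign_of_odd (P : Poly)
    (hO : P.foldr (fun (c : ℚ) (k : Bool → Bool) (odd : Bool) => (!odd || decide (c = 0)) && k (!odd)) (fun _ => true)
      true = true)
    (rs : List ℚ)
    (h : rs.foldr (fun (r : ℚ) (k : ℚ → Bool) (e : ℚ) => decide (0 < r) &&
        decide (0 < (Poly.shift P.tail e).headD 0 +
          r * (Poly.shift P.tail e).tail.foldr (fun c t => min 0 c + r * t) 0) &&
        k (e - r)) (fun e => decide (e < 0)) 1 = true) :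
    (∀ y ∈ Ioc (0 : ℝ) 1, 0 < Poly.eval P y) ∧ Poly.eval P 0 = 0 ∧ (∀ y ∈ Ico (-1 : ℝ) 0, Poly.eval P y < 0) := by
  match P, hO, h with
  | [], _, h =>
      exfalso
      cases rs with
      | nil => revert h; norm_num
      | cons r rs => simp [Poly.shift] at h
  | c :: R, hO, h =>
      have hO' := hO
      simp only [List.foldr_cons, Bool.and_eq_true] at hO'
      have hc : c = 0 := by simpa using hO'.1
      subst hc
      have hR : ∀ y : ℝ, 0 ≤ y → y ≤ 1 → 0 < Poly.eval R y := fun y h0 h1 =>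
        rs_chain_pos R 0 rs 1 h y (by simpa using h0) (by simpa using h1)
      refine ⟨fun y hy => ?_, by simp, fun y hy => ?_⟩
      · have := hR y hy.1.le hy.2
        simp only [Poly.eval_cons, Rat.cast_zero, zero_add]
        exact mul_pos hy.1 this
      · have hneg := rs_parity_eval_neg (0 :: R) true hO (-y)
        rw [neg_neg] at hneg
        simp only [↓reduceIte] at hneg
        have hpos : 0 < Poly.eval ((0 : ℚ) :: R) (-y) := by
          have := hR (-y) (by linarith [hy.2]) (by linarith [hy.1])
          simp only [Poly.eval_cons, Rat.cast_zero, zero_add]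
          exact mul_pos (by linarith [hy.2]) this
        linarith

/-- Window coordinates: a sign statement on the unit window transports to `v(x) = P(x/b)` on `[-b, b]` (`b > 0`). [folklore] -/
theorem rs_pos_window_of_unit (P : Poly) (hP : ∀ y ∈ Icc (-1 : ℝ) 1, 0 < Poly.eval P y) {b : ℝ} (hb : 0 < b) :
    ∀ x ∈ Icc (-b) b, 0 < Poly.eval P (x / b) := by
  intro x hx
  refine hP (x / b) ⟨?_, ?_⟩
  · rw [le_div_iff₀ hb]; linarith [hx.1]
  · rw [div_le_iff₀ hb]; linarith [hx.2]

/-! ## The certified Ritz ground vectors of the GroundBarta cells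

Each `…v1P` below is the lowest plain Rayleigh–Ritz vector of its parity sector at the cell's window (degree 54/55, resp. 67 for
the deflated odd vectors `f78v1P`, `f80v1P`), the vector whose certified Rayleigh quotient is the cell's U-side / block datum.
EVEN: no zero on `[-1, 1]`.  ODD: the single node `y = 0`. -/

section Cells

open Summit.RiemannHypothesis.RiemannHypothesis.Theorems.EvenWinsBeyondArch

/-- `b = 18/25`: the even Ritz ground vector `e72v1P` is strictly positive on the closed window. [folklore] -/
theorem e72v1_pos : ∀ y ∈ Icc (-1 : ℝ) 1, 0 < Poly.eval ArchP72E.e72v1P y :=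
  rs_pos_Icc_of_even _ (by decide) [1/200, 1/100, 1/50, 1/40, 1/20, 1/10, 1/10, 1/5, 1/5, 1/5, 1/5] (by decide +kernel)

/-- `b = 4023/5000`: the even Ritz ground vector `p80v1P` (U-side `trialUpper80sharp`) is strictly positive on the closed
window. [folklore] -/
theorem p80v1_pos : ∀ y ∈ Icc (-1 : ℝ) 1, 0 < Poly.eval ArchM80P.p80v1P y :=
  rs_pos_Icc_of_even _ (by decide) [1/200, 1/100, 1/40, 1/20, 1/10, 1/10, 1/5, 1/5, 1/5, 1/5] (by decide +kernel)

/-- `b = 2759087199219/3428634528742` (the `(log 5)/2` cell): the even Ritz ground vector `ne25v1P` is strictly positive on the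
closed window. [folklore] -/
theorem ne25v1_pos : ∀ y ∈ Icc (-1 : ℝ) 1, 0 < Poly.eval ArchN25E.ne25v1P y :=
  rs_pos_Icc_of_even _ (by decide) [1/200, 1/100, 1/40, 1/20, 1/10, 1/10, 1/5, 1/5, 1/5, 1/5] (by decide +kernel)

/-- `b = 83/100`: the even Ritz ground vector `ne83v1P` (the trial vector of `trialUpper83sharp : ε(83/100) ≤ 4.83·10⁻¹⁹`) is
strictly positive on the closed window. [folklore] -/
theorem ne83v1_pos : ∀ y ∈ Icc (-1 : ℝ) 1, 0 < Poly.eval ArchN83E.ne83v1P y :=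
  rs_pos_Icc_of_even _ (by decide) [1/100, 1/40, 1/20, 1/10, 1/10, 1/5, 1/5, 1/5, 1/5] (by decide +kernel)

/-- `b = 83/100`, window coordinates: `x ↦ ne83v1P (x / b) > 0` on `[-83/100, 83/100]`. [folklore] -/
theorem ne83v1_pos_window : ∀ x ∈ Icc (-(83 / 100 : ℝ)) (83 / 100), 0 < Poly.eval ArchN83E.ne83v1P (x / (83 / 100)) :=
  rs_pos_window_of_unit _ ne83v1_pos (by norm_num)

/-- `b = 77/100`: the odd Ritz ground vector `w77v1P` has exactly one node, at the centre. [folklore] -/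
theorem w77v1_sign : (∀ y ∈ Ioc (0 : ℝ) 1, 0 < Poly.eval ArchM77Y.w77v1P y) ∧ Poly.eval ArchM77Y.w77v1P 0 = 0 ∧
    (∀ y ∈ Ico (-1 : ℝ) 0, Poly.eval ArchM77Y.w77v1P y < 0) :=
  rs_sign_of_odd _ (by decide) [1/400, 1/200, 1/100, 1/50, 1/40, 1/20, 1/10, 1/10, 1/5, 1/5, 1/5, 1/5] (by decide +kernel)

/-- `b = 39/50` (plain): the odd Ritz ground vector `w78v1P` has exactly one node, at the centre. [folklore] -/
theorem w78v1_sign : (∀ y ∈ Ioc (0 : ℝ) 1, 0 < Poly.eval ArchM78Y.w78v1P y) ∧ Poly.eval ArchM78Y.w78v1P 0 = 0 ∧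
    (∀ y ∈ Ico (-1 : ℝ) 0, Poly.eval ArchM78Y.w78v1P y < 0) :=
  rs_sign_of_odd _ (by decide) [1/400, 1/200, 1/100, 1/50, 1/40, 1/20, 1/10, 1/10, 1/5, 1/5, 1/5, 1/5] (by decide +kernel)

/-- `b = 39/50` (deflated block, degree 67): the odd Ritz ground vector `f78v1P` has exactly one node, at the centre. [folklore] -/
theorem f78v1_sign : (∀ y ∈ Ioc (0 : ℝ) 1, 0 < Poly.eval ArchM78F.f78v1P y) ∧ Poly.eval ArchM78F.f78v1P 0 = 0 ∧
    (∀ y ∈ Ico (-1 : ℝ) 0, Poly.eval ArchM78F.f78v1P y < 0) :=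
  rs_sign_of_odd _ (by decide) [1/200, 1/100, 1/50, 1/40, 1/20, 1/20, 1/10, 1/10, 1/5, 1/5, 1/5, 1/5] (by decide +kernel)

/-- `b = 4023/5000` (deflated block, degree 67): the odd Ritz ground vector `f80v1P` has exactly one node, at the centre.
[folklore] -/
theorem f80v1_sign : (∀ y ∈ Ioc (0 : ℝ) 1, 0 < Poly.eval ArchM80F.f80v1P y) ∧ Poly.eval ArchM80F.f80v1P 0 = 0 ∧
    (∀ y ∈ Ico (-1 : ℝ) 0, Poly.eval ArchM80F.f80v1P y < 0) :=
  rs_sign_of_odd _ (by decide) [1/400, 1/200, 1/100, 1/40, 1/20, 1/20, 1/10, 1/10, 1/5, 1/5, 1/5, 1/5] (by decide +kernel)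

/-- `(log 5)/2` cell: the odd Ritz ground vector `no25v1P` has exactly one node, at the centre. [folklore] -/
theorem no25v1_sign : (∀ y ∈ Ioc (0 : ℝ) 1, 0 < Poly.eval ArchN25O.no25v1P y) ∧ Poly.eval ArchN25O.no25v1P 0 = 0 ∧
    (∀ y ∈ Ico (-1 : ℝ) 0, Poly.eval ArchN25O.no25v1P y < 0) :=
  rs_sign_of_odd _ (by decide) [1/200, 1/100, 1/40, 1/20, 1/10, 1/10, 1/5, 1/5, 1/5, 1/5] (by decide +kernel)

/-- `b = 83/100`: the odd Ritz ground vector `no83v1P` has exactly one node, at the centre. [folklore] -/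
theorem no83v1_sign : (∀ y ∈ Ioc (0 : ℝ) 1, 0 < Poly.eval ArchN83O.no83v1P y) ∧ Poly.eval ArchN83O.no83v1P 0 = 0 ∧
    (∀ y ∈ Ico (-1 : ℝ) 0, Poly.eval ArchN83O.no83v1P y < 0) :=
  rs_sign_of_odd _ (by decide) [1/200, 1/100, 1/40, 1/20, 1/10, 1/10, 1/5, 1/5, 1/5, 1/5] (by decide +kernel)

end Cells

end Summit.RiemannHypothesis.RiemannHypothesis.Theorems.PolarPerronFrobenius
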